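/-
Copyright (c) 2026. All rights reserved.
Released under Apache 2.0 license as described in the file LICENSE.
-/
import Literature.AlgebraicGeometry.ComplexMultiplication.HyperellipticJacobianSimpleFactorProductsExceptionalClasses
import HarnessLib

/-!
# `Y_{4p}` for every prime `p ≡ 1 (mod 4)`, `p ≠ 5`: the SIMPLE, DEGENERATE factor of `X_{4p} ∼ Y_{4p}²` carries a rational `((p−1)/4,(p−1)/4)`-class outside `𝓓 ⊗ ℂ` ON ITSELF — F39's class on `X_{4p}` is the preimage of a class of `Y_{4p}`; descent along a 2-to-1 restriction

Family `hodge`, cell `pub-hodgecm2` (COR-CM), KEPT Literature lane `lit-deligne-3` (generation 55, file F45; sequel of F39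
`HyperellipticJacobianFourTimesPrimeLevelExceptionalClasses` §1–§3 and of F42 `HyperellipticJacobianSimpleFactorProductsExceptionalClasses`).
THEOREMS ONLY: no definition, no named fact, no `sorry`, no instance; D-0026 net debt `0`.  Nothing here asserts the algebraicity of any class;
HC_CM is NOT proved.

THE POINT.  For `p ≡ 1 (mod 4)` (prime, `p ≠ 5`) F39 located an exceptional Hodge class of `J_{4p}` on the PIECE `X_{4p}` itself (dimension
`p − 1`, middle codimension `(p−1)/2`) through the weight `Δ = {σ : e(σ) ≡ 1 (mod 4)}` of `(ℚ(ζ_{4p}); Φ_{4p})`, and recorded that every sub-pair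
inducing `Φ_{4p}` — in particular GGL's simple factor `Y_{4p}` (`X_{4p} ∼ Y_{4p}²`, CM by `L = ℚ(ζ_{4p} − ζ_{4p}^{−1})`, dimension `(p−1)/2`) — is
DEGENERATE (Yanai: `dim MT(A) = dim A`).  Degenerate means exceptional classes on SOME power (Hazama); this file puts one ON `Y_{4p}` ITSELF.
F42's descent (injective restriction) does not apply — `Δ` is a union of FIBRES of `res : Hom(ℚ(ζ_{4p}), ℂ) → Hom(L, ℂ)`: if `σ|_L = σ'|_L` then
`e = e'` or `e + e' ≡ 2p ≡ 2 (mod 4)` (F42 `expOf_eq_or_add_mod_eq_of_apply_eq`), so `e ≡ 1 ⟺ e' ≡ 1 (mod 4)` (§2).  Instead (§1): for a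
2-to-1 restriction, the PREIMAGE `res^{−1}(T)` of `T ⊆ Hom(L, ℂ)` is balanced for `Ψ^K` iff `T` is balanced for `Ψ` (both counts double), and the
preimage of a DIVISORIAL `T` is divisorial (over a balanced pair `{ρ, ρ'}` lie the balanced pairs `{a, b}`, `{a', b'}`); hence `Δ = res^{−1}(res Δ)`
balanced and NON-divisorial (F39) forces `res Δ` — a `(p−1)/2`-subset of `Hom(L, ℂ)` — to be balanced and non-divisorial for `(L; Ψ)`: by Pohlmann's
theorem for the simple `Y_{4p} ⊨ (L; Ψ)` (the tree's `exists_exceptional_iff`), **`Y_{4p}` carries a rational `((p−1)/4, (p−1)/4)`-class outside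
`𝓓 ⊗ ℂ`**, in its MIDDLE codimension; it is not divisor-generated, not stably nondegenerate.  An INFINITE FAMILY of SIMPLE CM abelian varieties with
`B ≠ D` on themselves: `p = 13` (a sixfold, `B³ ≠ D³`), `p = 17` (an eightfold, `B⁴ ≠ D⁴`), `29, 37, 41, …`.

THE PRINT.  Pohlmann, Ann. of Math. 88 (1968) Thm. 1 and §3 (Mumford's CM fourfold with `B² ≠ D²` — the prototype); Gallese–Goodson–Lombardo (2024)
§1 (p. 4) «in most cases … exceptional Hodge cycles», §3 Thm. 3.0 (5) (`X_d ∼ Y_d²`, `Y_d` simple, CM by `ℚ(ζ_d − ζ_d^{−1})`), §3.2 Lemma 12, §3.3;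
Yanai (2015) §5 («when `p ≡ 1 (mod 4)`, `dim MT(A) = dim A`» for the Galois-conjugate Jacobian on the same field — typed in the lane's gen-47 file);
Shimura (1998) §6.2 Thm. 3 (induced types: `h` copies), §8.2 Prop. 26; Gordon (1999) 9.2.2, §9.3 (White: Pohlmann's criterion and degenerate types);
Milne (2020) 1.2 (c).  None of them prints a Hodge class on `Y_{4p}` itself.

WHAT IS PROVED.
* §1 (one field `K ⊇ L`, `Ψ` a CM type of `L`, `Ψ^K` the induced type) `card_filter_comp_mem` (`|res^{−1} T| = [K:L]·|T|`),
  **`isGaloisBalanced_filter_comp_iff`** (`res^{−1} T` balanced ⟺ `T` balanced), `filter_comp_mem_pohlmannSets_iff`, `pair_mem_pohlmannSets_one_of_comp_eq`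
  (lifts of a balanced pair), `exists_fibre_pair` (`[K:L] = 2`: the fibre `{a, a'}`), **`filter_comp_mem_pohlmannDivisorSets`** (`[K:L] = 2`: preimages of
  divisorial weights are divisorial), **`mem_diff_of_filter_comp_mem_diff`** (DESCENT ALONG A 2-TO-1 RESTRICTION: `res^{−1} T` exceptional ⟹ `T` exceptional).
* §2 `filter_comp_mem_eq_filter_mod_four` (`Δ = res^{−1}(res Δ)` for `N = 4p`, `p` odd, `ζ − ζ^{−1} ∈ L`).
* §3 **`exists_simpleFactor_exceptional_of_level_fourMulPrime_one_mod_four`** — `p ≡ 1 (mod 4)` prime, `p ≠ 5`, any realisation `A ⊨ (ℚ(ζ_{4p}); Φ_{4p})`: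
  the simple factor `B = Y_{4p}` (`A ∼ B²`, `2 dim B = p − 1`, CM field `ℚ(ζ_{4p} − ζ_{4p}^{−1})` of index `2`) has an exceptional weight in degree `(p−1)/4`
  and carries a rational `((p−1)/4,(p−1)/4)`-class outside `𝓓 ⊗ ℂ`; `¬IsDivisorGenerated B`, `¬IsStablyNondegenerate B`.
* §4 hypothesis-free **`exists_simple_exceptional_self_of_prime_one_mod_four`**: ∀ prime `p ≡ 1 (mod 4)`, `p ≠ 5`, ∃ a SIMPLE abelian variety `Y`,
  `2 dim Y = p − 1`, with a rational `((p−1)/4,(p−1)/4)`-class outside `𝓓 ⊗ ℂ` on `Y` itself, not divisor-generated, not stably nondegenerate.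

HONEST.  Assembled from tree theorems (F39's weight `Δ` with balance ∕ non-divisoriality, GGL Thm. 3.0 (5) as `exists_isogeny_sq_simple_of_four_dvd`,
Pohlmann's dictionary `exists_exceptional_iff`, F42's `ζ − ζ^{−1}` lemma) plus §1's elementary preimage transport (new, reusable for any index-2
sub-pair).  The located class on `Y_{4p}` itself was not found in print (presearch F40–F42; GGL p. 4 and Yanai §5 give degeneracy ∕ «exceptional Hodge
cycles» without location).  We do NOT identify the class with Weil classes of a subfield, and make no algebraicity claim.  `p = 5`: `X_{20} ∼ E⁴` is stably
nondegenerate (excluded).  No numerics.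

## References
* [Pohlmann1968] H. Pohlmann, Ann. of Math. (2) 88 (1968) 161–180, Thm. 1 and §3. [cite: Pohlmann1968, Thm. 1 and §3]
* [GalleseGoodsonLombardo2024] Gallese–Goodson–Lombardo, §1 (p. 4), §3 Thm. 3.0 (5), §3.2 Lemma 12, §3.3 [corpus: paper:arxiv-2405.20394 pp. 3–5].
  [cite: GalleseGoodsonLombardo2024, §3 Thm. 3.0 (5) and §3.2 Lemma 12]
* [Yanai2015IndexDegeneracy] H. Yanai (2015), §5 (pp. 818–819). [cite: Yanai2015IndexDegeneracy, §5 (p. 819)]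
* [Shimura1998] G. Shimura (1998), §6.2 Thm. 3, §8.2 Prop. 26. [cite: Shimura1998, §6.2 Thm. 3 and §8.2 Prop. 26]
* [Gordon1999HodgeAVSurvey] B. B. Gordon (1999), 9.2.2, §9.3, Thm. 7.5. [cite: Gordon1999HodgeAVSurvey, 9.2.2 and §9.3]
* [Milne2020HodgeClassesAV] J. S. Milne (2020), 1.2 (c). [cite: Milne2020HodgeClassesAV, 1.2 (c)]
* [vanGeemen1994HodgeAV] B. van Geemen, LNM 1594 (1994), §2.4–2.5. [cite: vanGeemen1994HodgeAV, §2.4]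
-/

open CategoryTheory CategoryTheory.Limits NumberField Module

namespace Literature.AlgebraicGeometry.ComplexMultiplication

open Literature.AlgebraicGeometry.Motives
open Literature.AlgebraicGeometry.Motives.AbelianVariety
open Literature.AlgebraicGeometry.HodgeTheory (complexBetti IsRationalClass IsOfHodgeType IsStablyNondegenerate
  IsDivisorGenerated HodgeConjectureFor)
open Literature.AlgebraicGeometry.VanGeemen1994 (hodgeClassSpan)
open Literature.Barriers.HodgeConjecture (divisorClassesSpan)
open Literature.NumberTheory.ComplexMultiplication

namespace HyperellipticJacobian

open Literature.AlgebraicGeometry.Pohlmann1968 Literature.AlgebraicGeometry.Pohlmann1968.Cyclotomic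
open Literature.AlgebraicGeometry.Pohlmann1968.CMAlgebra

/-! ## §1 Preimages of weights under restriction `Hom(K, ℂ) → Hom(L, ℂ)`: balance is preserved and reflected, divisoriality is preserved -/

section Preimage

variable {K : Type} [Field K] [NumberField K] {L : IntermediateField ℚ K} {Ψ : CMType L}
  [DecidableEq (K →+* ℂ)] [DecidableEq (L →+* ℂ)]

/-- The preimage of `T ⊆ Hom(L, ℂ)` under restriction has `[K : L] · |T|` elements (every fibre has `[K : L]` elements, the tree's
`card_filter_comp_algebraMap_eq_finrank`). [cite: Shimura1998, §6.2 Thm. 3 (proof)] -/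
theorem card_filter_comp_mem (T : Finset (L →+* ℂ)) :
    (Finset.univ.filter fun σ : K →+* ℂ => σ.comp (algebraMap L K) ∈ T).card = Module.finrank L K * T.card := by
  classical
  have hset : (Finset.univ.filter fun σ : K →+* ℂ => σ.comp (algebraMap L K) ∈ T) =
      T.biUnion fun ρ => Finset.univ.filter fun σ : K →+* ℂ => σ.comp (algebraMap L K) = ρ := by
    ext σ
    simp only [Finset.mem_filter, Finset.mem_univ, true_and, Finset.mem_biUnion, exists_eq_right']
  rw [hset, Finset.card_biUnion]
  · have hc : ∀ ρ ∈ T, (Finset.univ.filter fun σ : K →+* ℂ => σ.comp (algebraMap L K) = ρ).card = Module.finrank L K :=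
      fun ρ _ => by convert card_filter_comp_algebraMap_eq_finrank (K := K) (K₁ := L) ρ
    rw [Finset.sum_const_nat hc, mul_comm]
  · intro ρ _ ρ' _ hne
    exact Finset.disjoint_filter.2 fun σ _ h h' => hne (h.symm.trans h')

/-- Counting the members of the preimage whose restriction has a property: `[K : L]` times the count on `T`. [folklore] -/
private theorem ncard_sep_filter_comp (T : Finset (L →+* ℂ)) (Q : (L →+* ℂ) → Prop) :
    {σ | σ ∈ (Finset.univ.filter fun σ : K →+* ℂ => σ.comp (algebraMap L K) ∈ T) ∧ Q (σ.comp (algebraMap L K))}.ncard =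
      Module.finrank L K * {ρ | ρ ∈ T ∧ Q ρ}.ncard := by
  classical
  have h1 : {σ | σ ∈ (Finset.univ.filter fun σ : K →+* ℂ => σ.comp (algebraMap L K) ∈ T) ∧ Q (σ.comp (algebraMap L K))} =
      ↑(Finset.univ.filter fun σ : K →+* ℂ => σ.comp (algebraMap L K) ∈ T.filter Q) := by
    ext σ
    simp only [Set.mem_setOf_eq, Finset.coe_filter, Finset.mem_filter, Finset.mem_univ, true_and]
  have h2 : {ρ | ρ ∈ T ∧ Q ρ} = ↑(T.filter Q) := by
    ext ρ
    simp only [Set.mem_setOf_eq, Finset.coe_filter]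
  rw [h1, h2, Set.ncard_coe_finset, Set.ncard_coe_finset, card_filter_comp_mem]

/-- **Pohlmann's condition for the preimage `res^{−1}(T)` and `Ψ^K` is Pohlmann's condition for `T` and `Ψ`** (`τσ ∈ Ψ^K ⟺ τ(σ|_L) ∈ Ψ`;
every fibre has `[K : L]` elements, so both counts are multiplied by `[K : L]`). [cite: Milne2020HodgeClassesAV, 1.2 (c)]
[cite: Gordon1999HodgeAVSurvey, §9.2 (9.2.1)] [cite: Shimura1998, §6.2 Thm. 3] -/
theorem isGaloisBalanced_filter_comp_iff (T : Finset (L →+* ℂ)) :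
    IsGaloisBalanced (inducedCMType (algebraMap L K) Ψ) (Finset.univ.filter fun σ : K →+* ℂ => σ.comp (algebraMap L K) ∈ T) ↔
      IsGaloisBalanced Ψ T := by
  classical
  rw [isGaloisBalanced_iff, isGaloisBalanced_iff]
  refine forall_congr' fun τ => ?_
  have e1 : {s | s ∈ (Finset.univ.filter fun σ : K →+* ℂ => σ.comp (algebraMap L K) ∈ T) ∧
        (τ : ℂ →+* ℂ).comp s ∈ (inducedCMType (algebraMap L K) Ψ).1} =
      {s | s ∈ (Finset.univ.filter fun σ : K →+* ℂ => σ.comp (algebraMap L K) ∈ T) ∧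
        (fun ρ : L →+* ℂ => (τ : ℂ →+* ℂ).comp ρ ∈ Ψ.1) (s.comp (algebraMap L K))} := by
    ext s
    simp only [Set.mem_setOf_eq, comp_mem_inducedCMType_iff]
  have e2 : {s | s ∈ (Finset.univ.filter fun σ : K →+* ℂ => σ.comp (algebraMap L K) ∈ T) ∧
        (τ : ℂ →+* ℂ).comp s ∉ (inducedCMType (algebraMap L K) Ψ).1} =
      {s | s ∈ (Finset.univ.filter fun σ : K →+* ℂ => σ.comp (algebraMap L K) ∈ T) ∧
        (fun ρ : L →+* ℂ => (τ : ℂ →+* ℂ).comp ρ ∉ Ψ.1) (s.comp (algebraMap L K))} := by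
    ext s
    simp only [Set.mem_setOf_eq, comp_mem_inducedCMType_iff]
  rw [e1, e2, ncard_sep_filter_comp T (fun ρ : L →+* ℂ => (τ : ℂ →+* ℂ).comp ρ ∈ Ψ.1),
    ncard_sep_filter_comp T (fun ρ : L →+* ℂ => (τ : ℂ →+* ℂ).comp ρ ∉ Ψ.1)]
  constructor
  · exact fun h => Nat.eq_of_mul_eq_mul_left Module.finrank_pos h
  · exact fun h => by rw [h]

/-- **`res^{−1}(T) ∈ pohlmannSets Ψ^K ([K:L]·r) ⟺ T ∈ pohlmannSets Ψ r`.** [cite: Milne2020HodgeClassesAV, 1.2 (c)] [cite: Pohlmann1968, Thm. 1] -/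
theorem filter_comp_mem_pohlmannSets_iff (r : ℕ) (T : Finset (L →+* ℂ)) :
    (Finset.univ.filter fun σ : K →+* ℂ => σ.comp (algebraMap L K) ∈ T) ∈
        pohlmannSets (inducedCMType (algebraMap L K) Ψ) (Module.finrank L K * r) ↔
      T ∈ pohlmannSets Ψ r := by
  rw [mem_pohlmannSets_iff, mem_pohlmannSets_iff, card_filter_comp_mem, isGaloisBalanced_filter_comp_iff]
  refine and_congr ⟨fun h => ?_, fun h => ?_⟩ Iff.rfl
  · exact Nat.eq_of_mul_eq_mul_left Module.finrank_pos (by rw [h]; ring)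
  · rw [h]; ring

/-- Counting the members of a pair with a property. [folklore] -/
private theorem ncard_sep_pair {α : Type*} [DecidableEq α] {a b : α} (hab : a ≠ b) (Q : α → Prop) [DecidablePred Q] :
    {x | x ∈ ({a, b} : Finset α) ∧ Q x}.ncard = (if Q a then 1 else 0) + (if Q b then 1 else 0) := by
  classical
  rw [show {x | x ∈ ({a, b} : Finset α) ∧ Q x} = ↑(({a, b} : Finset α).filter Q) by rw [Finset.coe_filter],
    Set.ncard_coe_finset, Finset.filter_insert, Finset.filter_singleton]
  by_cases ha : Q a <;> by_cases hb : Q b <;> simp [ha, hb, hab]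

/-- **Lifts of a balanced pair form a balanced pair**: if `{ρ, ρ'}` is a balanced pair of `Ψ` and `a|_L = ρ`, `b|_L = ρ'`, then `{a, b}` is a
balanced pair of `Ψ^K`. [cite: Pohlmann1968, Thm. 1] [cite: Gordon1999HodgeAVSurvey, §9.2 (9.2.1) and 9.2.2] -/
theorem pair_mem_pohlmannSets_one_of_comp_eq {ρ ρ' : L →+* ℂ} (h : ({ρ, ρ'} : Finset (L →+* ℂ)) ∈ pohlmannSets Ψ 1)
    {a b : K →+* ℂ} (ha : a.comp (algebraMap L K) = ρ) (hb : b.comp (algebraMap L K) = ρ') :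
    ({a, b} : Finset (K →+* ℂ)) ∈ pohlmannSets (inducedCMType (algebraMap L K) Ψ) 1 := by
  classical
  have hρ : ρ ≠ ρ' := by
    rintro rfl
    have := h.1
    rw [Finset.pair_eq_singleton, Finset.card_singleton] at this
    omega
  have hab : a ≠ b := by
    rintro rfl
    exact hρ (ha.symm.trans hb)
  refine ⟨Finset.card_pair hab, fun τ => ?_⟩
  have hbal := h.2 τ
  rw [ncard_sep_pair hρ, ncard_sep_pair hρ] at hbal
  rw [ncard_sep_pair hab, ncard_sep_pair hab, comp_mem_inducedCMType_iff, comp_mem_inducedCMType_iff, ha, hb]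
  exact hbal

omit [DecidableEq (L →+* ℂ)] in
/-- The fibre of restriction over `ρ` for `[K : L] = 2`: two embeddings `a ≠ a'`, and every embedding over `ρ` is one of them.
[cite: Shimura1998, §6.2 Thm. 3 (proof)] -/
theorem exists_fibre_pair (hfin : Module.finrank L K = 2) (ρ : L →+* ℂ) :
    ∃ a a' : K →+* ℂ, a ≠ a' ∧ a.comp (algebraMap L K) = ρ ∧ a'.comp (algebraMap L K) = ρ ∧
      ∀ σ : K →+* ℂ, σ.comp (algebraMap L K) = ρ → σ = a ∨ σ = a' := by
  classical
  have hcard := card_filter_comp_algebraMap_eq_finrank (K := K) (K₁ := L) ρ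
  rw [hfin] at hcard
  obtain ⟨a, a', hne, hset⟩ := Finset.card_eq_two.1 hcard
  have hmem : ∀ σ : K →+* ℂ, σ.comp (algebraMap L K) = ρ ↔ σ = a ∨ σ = a' := fun σ => by
    have := Finset.ext_iff.1 hset σ
    simp only [Finset.mem_filter, Finset.mem_univ, true_and, Finset.mem_insert, Finset.mem_singleton] at this
    exact this
  exact ⟨a, a', hne, (hmem a).2 (Or.inl rfl), (hmem a').2 (Or.inr rfl), fun σ h => (hmem σ).1 h⟩

/-- **Preimages of divisorial weights are divisorial** (`[K : L] = 2`): if `T` is a disjoint union of `r` balanced pairs of `Ψ`, then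
`res^{−1}(T)` is a disjoint union of `2r` balanced pairs of `Ψ^K` — over a pair `{ρ, ρ'}` lie the two pairs `{a, b}`, `{a', b'}`.
[cite: Gordon1999HodgeAVSurvey, 9.2.2] [cite: vanGeemen1994HodgeAV, §2.4] [cite: Shimura1998, §6.2 Thm. 3] -/
theorem filter_comp_mem_pohlmannDivisorSets (hfin : Module.finrank L K = 2) :
    ∀ (r : ℕ) (T : Finset (L →+* ℂ)), T ∈ pohlmannDivisorSets Ψ r →
      (Finset.univ.filter fun σ : K →+* ℂ => σ.comp (algebraMap L K) ∈ T) ∈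
        pohlmannDivisorSets (inducedCMType (algebraMap L K) Ψ) (2 * r)
  | 0, T, hT => by
    classical
    rw [pohlmannDivisorSets_def, mem_disjointUnionsOf_zero] at hT
    subst hT
    rw [Nat.mul_zero, pohlmannDivisorSets_def, mem_disjointUnionsOf_zero]
    ext σ
    simp
  | r + 1, T, hT => by
    classical
    rw [pohlmannDivisorSets_def, mem_disjointUnionsOf_succ] at hT
    obtain ⟨s, hs, t, ht, hst, rfl⟩ := hT
    rw [← pohlmannDivisorSets_def] at hs
    have IH := filter_comp_mem_pohlmannDivisorSets hfin r s hs
    obtain ⟨ρ, ρ', hρne, rfl⟩ := Finset.card_eq_two.1 ht.1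
    obtain ⟨a, a', haa', ha, ha', hfa⟩ := exists_fibre_pair hfin ρ
    obtain ⟨b, b', hbb', hb, hb', hfb⟩ := exists_fibre_pair hfin ρ'
    have hpab : ({a, b} : Finset (K →+* ℂ)) ∈ pohlmannSets (inducedCMType (algebraMap L K) Ψ) 1 :=
      pair_mem_pohlmannSets_one_of_comp_eq ht ha hb
    have hpab' : ({a', b'} : Finset (K →+* ℂ)) ∈ pohlmannSets (inducedCMType (algebraMap L K) Ψ) 1 :=
      pair_mem_pohlmannSets_one_of_comp_eq ht ha' hb'
    have hρs : ρ ∉ s := fun h => Finset.disjoint_left.1 hst h (by simp)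
    have hρ's : ρ' ∉ s := fun h => Finset.disjoint_left.1 hst h (by simp)
    have hab' : a ≠ b' := fun h => hρne (ha.symm.trans (h ▸ hb'))
    have ha'b : a' ≠ b := fun h => hρne (ha'.symm.trans (h ▸ hb))
    have hdisj1 : Disjoint (Finset.univ.filter fun σ : K →+* ℂ => σ.comp (algebraMap L K) ∈ s) {a, b} := by
      refine Finset.disjoint_left.2 fun σ hσ hσ' => ?_
      rw [Finset.mem_filter] at hσ
      simp only [Finset.mem_insert, Finset.mem_singleton] at hσ'
      rcases hσ' with rfl | rfl
      · exact hρs (ha ▸ hσ.2)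
      · exact hρ's (hb ▸ hσ.2)
    have hdisj2 : Disjoint ((Finset.univ.filter fun σ : K →+* ℂ => σ.comp (algebraMap L K) ∈ s).disjUnion {a, b} hdisj1) {a', b'} := by
      refine Finset.disjoint_left.2 fun σ hσ hσ' => ?_
      rw [Finset.mem_disjUnion, Finset.mem_filter] at hσ
      simp only [Finset.mem_insert, Finset.mem_singleton] at hσ'
      rcases hσ' with rfl | rfl
      · rcases hσ with ⟨-, h⟩ | h
        · exact hρs (ha' ▸ h)
        · simp only [Finset.mem_insert, Finset.mem_singleton] at h
          rcases h with h | h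
          · exact haa' h.symm
          · exact ha'b h
      · rcases hσ with ⟨-, h⟩ | h
        · exact hρ's (hb' ▸ h)
        · simp only [Finset.mem_insert, Finset.mem_singleton] at h
          rcases h with h | h
          · exact hab' h.symm
          · exact hbb' h.symm
    have heq : (Finset.univ.filter fun σ : K →+* ℂ => σ.comp (algebraMap L K) ∈ s.disjUnion {ρ, ρ'} hst) =
        ((Finset.univ.filter fun σ : K →+* ℂ => σ.comp (algebraMap L K) ∈ s).disjUnion {a, b} hdisj1).disjUnion {a', b'} hdisj2 := by
      ext σ
      simp only [Finset.mem_filter, Finset.mem_univ, true_and, Finset.mem_disjUnion, Finset.mem_insert, Finset.mem_singleton]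
      constructor
      · rintro (h | h | h)
        · exact Or.inl (Or.inl h)
        · rcases hfa σ h with rfl | rfl
          · exact Or.inl (Or.inr (Or.inl rfl))
          · exact Or.inr (Or.inl rfl)
        · rcases hfb σ h with rfl | rfl
          · exact Or.inl (Or.inr (Or.inr rfl))
          · exact Or.inr (Or.inr rfl)
      · rintro ((h | rfl | rfl) | rfl | rfl)
        · exact Or.inl h
        · exact Or.inr (Or.inl ha)
        · exact Or.inr (Or.inr hb)
        · exact Or.inr (Or.inl ha')
        · exact Or.inr (Or.inr hb')
    rw [heq, show 2 * (r + 1) = 2 * r + 1 + 1 by ring, pohlmannDivisorSets_def, mem_disjointUnionsOf_succ]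
    refine ⟨(Finset.univ.filter fun σ : K →+* ℂ => σ.comp (algebraMap L K) ∈ s).disjUnion {a, b} hdisj1, ?_, {a', b'}, hpab',
      hdisj2, rfl⟩
    rw [mem_disjointUnionsOf_succ]
    exact ⟨_, by rwa [pohlmannDivisorSets_def] at IH, {a, b}, hpab, hdisj1, rfl⟩

/-- **DESCENT ALONG A 2-TO-1 RESTRICTION.**  If the preimage `res^{−1}(T)` of `T ⊆ Hom(L, ℂ)` is a balanced NON-divisorial `4r`-subset for `Ψ^K`
(`[K : L] = 2`), then `T` is a balanced non-divisorial `2r`-subset for `Ψ`: an exceptional weight of `X ∼ Y²` that is a union of fibres is the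
preimage of an exceptional weight of the SIMPLE factor `Y` ITSELF. [cite: Shimura1998, §6.2 Thm. 3 and §8.2 Prop. 26]
[cite: Gordon1999HodgeAVSurvey, 9.2.2 and §9.3] [cite: Pohlmann1968, Thm. 1] -/
theorem mem_diff_of_filter_comp_mem_diff (hfin : Module.finrank L K = 2) {r : ℕ} {T : Finset (L →+* ℂ)}
    (h : (Finset.univ.filter fun σ : K →+* ℂ => σ.comp (algebraMap L K) ∈ T) ∈
      pohlmannSets (inducedCMType (algebraMap L K) Ψ) (2 * r) \ pohlmannDivisorSets (inducedCMType (algebraMap L K) Ψ) (2 * r)) :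
    T ∈ pohlmannSets Ψ r \ pohlmannDivisorSets Ψ r := by
  refine ⟨(filter_comp_mem_pohlmannSets_iff (Ψ := Ψ) r T).1 (by rw [hfin]; exact h.1),
    fun hT => h.2 (filter_comp_mem_pohlmannDivisorSets hfin r T hT)⟩

end Preimage

/-! ## §2 `p ≡ 1 (mod 4)`: F39's weight `Δ = {σ : e(σ) ≡ 1 (mod 4)}` of `X_{4p}` is a union of fibres over `ℚ(ζ_{4p} − ζ_{4p}^{−1})` -/

section Fibres

variable {N : ℕ} [NeZero N] {K : Type} [Field K] [NumberField K] [IsCyclotomicExtension {N} ℚ K] {L : IntermediateField ℚ K}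
  [DecidableEq (L →+* ℂ)]

/-- **`Δ` is a union of fibres**: if `σ|_L = σ'|_L` with `ζ − ζ^{−1} ∈ L` (`N = 4p`, `p` odd) and `e(σ') ≡ 1 (mod 4)`, then `e(σ) ≡ 1 (mod 4)`
(`e = e'` or `e + e' ≡ 2p ≡ 2 (mod 4)`, F42 `expOf_eq_or_add_mod_eq_of_apply_eq`); hence `Δ = res^{−1}(res(Δ))`.
[cite: GalleseGoodsonLombardo2024, §3.2 Lemma 12 and §3.3] -/
theorem filter_comp_mem_eq_filter_mod_four {p : ℕ} (hp2 : p % 2 = 1) (hN : N = 4 * p)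
    (hζ : zetaOf N K - (zetaOf N K)⁻¹ ∈ L) [DecidablePred fun ρ : L →+* ℂ =>
      ∃ σ : K →+* ℂ, σ.comp (algebraMap L K) = ρ ∧ (expOf N K σ).val % 4 = 1] :
    (Finset.univ.filter fun σ : K →+* ℂ => σ.comp (algebraMap L K) ∈
        (Finset.univ.filter fun ρ : L →+* ℂ => ∃ σ : K →+* ℂ, σ.comp (algebraMap L K) = ρ ∧ (expOf N K σ).val % 4 = 1)) =
      Finset.univ.filter fun σ : K →+* ℂ => (expOf N K σ).val % 4 = 1 := by
  classical
  subst hN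
  ext σ
  simp only [Finset.mem_filter, Finset.mem_univ, true_and]
  constructor
  · rintro ⟨σ', hσ', h1⟩
    have happ : σ' (zetaOf (4 * p) K - (zetaOf (4 * p) K)⁻¹) = σ (zetaOf (4 * p) K - (zetaOf (4 * p) K)⁻¹) := by
      have := RingHom.congr_fun hσ' ⟨_, hζ⟩
      simpa using this
    rcases expOf_eq_or_add_mod_eq_of_apply_eq (d := 4 * p) ⟨2 * p, by ring⟩ happ with he | hsum
    · rw [he]; exact h1
    · have h4 : ((expOf (4 * p) K σ').val + (expOf (4 * p) K σ).val) % 4 = 2 := by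
        have := Nat.mod_mod_of_dvd ((expOf (4 * p) K σ').val + (expOf (4 * p) K σ).val) (dvd_mul_right 4 p)
        rw [hsum] at this
        omega
      omega
  · intro h
    exact ⟨σ, rfl, h⟩

end Fibres

/-! ## §3 `Y_{4p}` (`p ≡ 1 (mod 4)`, `p ≠ 5` prime): the SIMPLE, DEGENERATE factor of `X_{4p} ∼ Y_{4p}²` carries a rational
## `((p−1)/4, (p−1)/4)`-class outside `𝓓 ⊗ ℂ` ON ITSELF -/

section OneModFour

variable {N : ℕ} [NeZero N] {K : Type} [Field K] [NumberField K] [IsCyclotomicExtension {N} ℚ K]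

/-- **`p ≡ 1 (mod 4)`, `p ≠ 5`: THE SIMPLE FACTOR `Y_{4p}` OF `X_{4p} ∼ Y_{4p}²` (dimension `(p−1)/2`, CM by `ℚ(ζ_{4p} − ζ_{4p}^{−1})`, a
DEGENERATE primitive type) CARRIES A RATIONAL `((p−1)/4, (p−1)/4)`-CLASS OUTSIDE `𝓓 ⊗ ℂ` ON ITSELF** (middle codimension `dim/2`).  For every
realisation `A ⊨ (ℚ(ζ_{4p}); Φ_{4p})`: the sub-pair `(L; Ψ)` and its SIMPLE realisation `B = Y_{4p}` with `A ∼ B²` (GGL Thm. 3.0 (5)); F39's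
exceptional weight `Δ = {σ : e(σ) ≡ 1 (mod 4)}` of `X_{4p}` is the preimage of the weight `res(Δ)` of `(L; Ψ)` (§2), which is therefore balanced
and NOT divisorial (§1): `B` carries an exceptional class, is NOT divisor-generated and NOT stably nondegenerate — an INFINITE FAMILY of
simple CM abelian varieties with `B ≠ D` on themselves (`p = 13`: a simple CM sixfold with `B³ ≠ D³`; `p = 17`: an eightfold with `B⁴ ≠ D⁴`).
Yanai ∕ GGL print the degeneracy (`dim MT = dim`) and «in most cases … exceptional Hodge cycles», not this class.
[cite: GalleseGoodsonLombardo2024, §1 (p. 4), §3 Thm. 3.0 (5) and Lemma 12] [cite: Pohlmann1968, Thm. 1 and §3] [cite: Gordon1999HodgeAVSurvey, 9.2.2 and §9.3]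
[cite: Shimura1998, §6.2 Thm. 3 and §8.2 Prop. 26] -/
theorem exists_simpleFactor_exceptional_of_level_fourMulPrime_one_mod_four {p : ℕ} (hp : p.Prime) (hp1 : p % 4 = 1) (hp5 : p ≠ 5)
    (hN : N = 4 * p) (Φ : CMType K) (hΦ : ∀ σ : K →+* ℂ, σ ∈ Φ.1 ↔ 2 * (expOf N K σ).val < N)
    {A : AbelianVariety ℂ} {ι : 𝓞 K →+* End A} {θ : K →+* Module.End ℂ (complexBetti A.X 1)} (hA : IsCMTypeRealisation Φ A ι θ) :
    ∃ (L : IntermediateField ℚ K) (Ψ : CMType L) (B : AbelianVariety ℂ) (ιB : 𝓞 L →+* End B)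
      (θB : L →+* Module.End ℂ (complexBetti B.X 1)),
      IsCMField L ∧ inducedCMType (algebraMap L K) Ψ = Φ ∧ Module.finrank L K = 2 ∧
      L = IntermediateField.adjoin ℚ {zetaOf N K - (zetaOf N K)⁻¹} ∧ IsCMTypeRealisation Ψ B ιB θB ∧ B.IsSimple ∧
      2 * B.dim = p - 1 ∧ IsIsogenous A (⨁ fun _ : Fin 2 => B) ∧
      (pohlmannSets Ψ ((p - 1) / 4) \ pohlmannDivisorSets Ψ ((p - 1) / 4)).Nonempty ∧
      (∃ c : complexBetti B.X (2 * ((p - 1) / 4)), IsRationalClass c ∧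
        IsOfHodgeType B.dim B.X (2 * ((p - 1) / 4)) ((p - 1) / 4) ((p - 1) / 4) c ∧ c ∉ divisorClassesSpan B.X B.dim ((p - 1) / 4)) ∧
      ¬IsDivisorGenerated B ∧ ¬IsStablyNondegenerate B := by
  classical
  have hp2 : p ≠ 2 := by omega
  have hp13 : 13 ≤ p := by
    rcases Nat.lt_or_ge p 13 with h | h
    · interval_cases p <;> simp_all (config := { decide := true })
    · exact h
  have h4 : 4 ∣ N := ⟨p, hN⟩
  have h8 : 8 ≤ N := by omega
  have h20 : N ≠ 20 := by omega
  have h24 : N ≠ 24 := by omega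
  have h60 : N ≠ 60 := by omega
  obtain ⟨-, L, Ψ, B, ιB, θB, hCM, hind, hfin, hL, hB, hs, hdim, P, π, hP, g, hg, -⟩ :=
    exists_isogeny_sq_simple_of_four_dvd h4 h8 h20 h24 h60 Φ hΦ hA
  haveI : IsCMField L := hCM
  have hiso : IsIsogenous A (⨁ fun _ : Fin 2 => B) := isIsogenous_biproduct_const_of_isLimit_fan hP hg
  have hζ : zetaOf N K - (zetaOf N K)⁻¹ ∈ L := by rw [hL]; exact IntermediateField.subset_adjoin ℚ _ (Set.mem_singleton _)
  -- F39's weight on `X_{4p}`, read for `Φ = Ψ^K`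
  have hΔ := filter_expOf_mod_four_eq_one_mem_pohlmannSets_diff hp hp1 hp5 hN Φ hΦ
  rw [← hind, ← filter_comp_mem_eq_filter_mod_four (L := L) (by omega) hN hζ,
    show (p - 1) / 2 = 2 * ((p - 1) / 4) by omega] at hΔ
  have hne : (pohlmannSets Ψ ((p - 1) / 4) \ pohlmannDivisorSets Ψ ((p - 1) / 4)).Nonempty :=
    ⟨_, mem_diff_of_filter_comp_mem_diff hfin hΔ⟩
  -- dimensions
  have htot : Nat.totient N = 2 * (p - 1) := by
    rw [hN, show 4 = 2 ^ 2 by norm_num, Nat.totient_mul ((Nat.coprime_pow_left_iff (by norm_num) 2 p).2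
      ((Nat.coprime_primes (by decide) hp).2 hp2.symm)), Nat.totient_prime_pow (by decide) (by norm_num), Nat.totient_prime hp]
    norm_num
  have hdimB : 2 * B.dim = p - 1 := by rw [htot] at hdim; omega
  have hdimL : Module.finrank ℚ L / 2 = B.dim := by
    rw [finrank_eq_two_mul_dim_of_isCMTypeRealisation hB]; omega
  obtain ⟨c, hcQ, hcH, hcD⟩ := (exists_exceptional_iff hB _).2 hne
  rw [hdimL] at hcH hcD
  have hnotD : ¬IsDivisorGenerated B := fun hD => hcD (hD _ c hcQ hcH)
  exact ⟨L, Ψ, B, ιB, θB, hCM, hind, hfin, hL, hB, hs, hdimB, hiso, hne, ⟨c, hcQ, hcH, hcD⟩, hnotD,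
    not_isStablyNondegenerate_of_exists_exceptional hcQ hcH hcD⟩

end OneModFour

/-! ## §4 Hypothesis-free: an infinite family of SIMPLE CM abelian varieties with an exceptional Hodge class on themselves -/

section Existence

/-- **FOR EVERY PRIME `p ≡ 1 (mod 4)`, `p ≠ 5`, A SIMPLE CM ABELIAN VARIETY `Y` OF DIMENSION `(p−1)/2` WITH A RATIONAL `((p−1)/4,(p−1)/4)`-CLASS
OUTSIDE `𝓓 ⊗ ℂ` ON `Y` ITSELF** (`Y = Y_{4p}`, the simple factor of `X_{4p} ⊂ J_{4p}`, complex multiplication by `ℚ(ζ_{4p} − ζ_{4p}^{−1})`);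
`Y` is not divisor-generated, not stably nondegenerate. [cite: GalleseGoodsonLombardo2024, §3 Thm. 3.0 (5) and Lemma 12]
[cite: Pohlmann1968, Thm. 1 and §3] [cite: Shimura1998, §6.2 Thm. 3 and §8.2 Prop. 26] -/
theorem exists_simple_exceptional_self_of_prime_one_mod_four {p : ℕ} (hp : p.Prime) (hp1 : p % 4 = 1) (hp5 : p ≠ 5) :
    ∃ Y : AbelianVariety ℂ, Y.IsSimple ∧ 2 * Y.dim = p - 1 ∧
      (∃ c : complexBetti Y.X (2 * ((p - 1) / 4)), IsRationalClass c ∧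
        IsOfHodgeType Y.dim Y.X (2 * ((p - 1) / 4)) ((p - 1) / 4) ((p - 1) / 4) c ∧ c ∉ divisorClassesSpan Y.X Y.dim ((p - 1) / 4)) ∧
      ¬IsDivisorGenerated Y ∧ ¬IsStablyNondegenerate Y := by
  obtain ⟨K, _, _, _, _, Φ, A, ι, θ, hΦ, hA⟩ := exists_realisation_family (![4 * p] : Fin 1 → ℕ)
    (fun i => by
      fin_cases i
      show (4 * p : ℕ) = 4 * (4 * p / 4)
      rw [Nat.mul_div_cancel_left p (by norm_num)])
    (fun i => by
      fin_cases i
      show 0 < 4 * p / 4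
      rw [Nat.mul_div_cancel_left p (by norm_num)]; exact hp.pos)
  obtain ⟨L, Ψ, B, ιB, θB, -, -, -, -, -, hs, hdim, -, -, hc, hD, hS⟩ :=
    exists_simpleFactor_exceptional_of_level_fourMulPrime_one_mod_four (N := (![4 * p] : Fin 1 → ℕ) 0) hp hp1 hp5 rfl (Φ 0) (hΦ 0) (hA 0)
  exact ⟨B, hs, hdim, hc, hD, hS⟩

end Existence

end HyperellipticJacobian

end Literature.AlgebraicGeometry.ComplexMultiplication
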